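import Summits.ABC.IUTFork.Conditional.AbcOfSGenuineKChosenDepthHexSharpEngine
import HarnessLib

/-!
# Branch C «HEX-SHARP», engine PARAMETRIC IN THE LOCAL TYPE (R-W lane P−, W-SPEC §2e F1-4 / §6): the depth threshold of the
# `λ_k` family as a function of a per-place ramification bound `e(K_x/ℚ_7) ≤ E` — with the LOCAL-TYPE LEMMA's `E = 30·l` / `60·l`
# the kernel reaches `k ≥ 13 / 15` at `l = 11`, `k ≥ 12 / 14` at `l = 13`, `k ≥ 11 / 13` for `17 ≤ l ≤ 67`

PROOF-ONLY file (0 definitions, 0 `Prop` facts, no instance) of the abc-iut cell (seat abc-iut-w5-d163, gen 7; HEX-SHARP prover #1, sequel of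
`AbcOfSGenuineKChosenDepthHexSharpEngine` p457581). TAKES NO SIDE on [IUTchIII] Cor. 3.12 or on any author.

WHY. p457581 proved the top-label depth inequality over `7` for every genuine Θ-volume datum over `(λ_k, l)` from `e(K_x/ℚ_7) ≤ 46080·l`
(`GenuineK.absRamificationIdx_kOf_le_ratPoint`: `e(x|v) ∣ l` times abc-iut-S1's two-root bound `e(v|7) ≤ 46080`), giving `k ≥ 21/20/21`.
The numerics of record (rw-num-lead README F1-4, WINDOW-SPEC §2e) say the decisive input is `b = ⌊log₇(7e_w/6)⌋ ≤ 3`, i.e. the LOCAL TYPE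
of `F‡ = ℚ(√−1, √λ, √(λ−1), E_λ[15])` at `7`: `e(v|7) ∣ 30` (Tate uniformisation; cyclic tame inertia), hence `e_w ∣ 30·l` — the
«LOCAL-TYPE LEMMA» held by abc-iut-W-neg-1 (C-R39a/C-R40). This file makes the engine PARAMETRIC in that input, so that the lemma, when it
lands, is consumed by ONE `fun x => …`:

* §1 `GenuineK.exists_deep_place_lamSeven_of_ramBound` — for `l` prime `≥ 11`, `k ≥ 1`, a bound `E` with
  `∀ x | 7, e(K_x/ℚ_7) ≤ E`, `E < 6·7ⁿ`, and the floor-free integer criterion `l·((l+1)(10n+12)+20) ≤ 5k(l−3)(l+1)`: the top label over `7`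
  is deep at EVERY datum (abc-iut-w5-d107's explicit inequality at the CHOSEN realising q-idele; `hdeep` of p438886).
* §2 under the hypothesis binder `hloc30 : ∀ x | 7, e(K_x/ℚ_7) ≤ 30·l` (the LOCAL-TYPE LEMMA's conclusion in the sharp form
  `e(x|v) ∣ l`, `e(v|7) ∣ 30`; `n = 3` for `l ≤ 68`): `…_of_localType30_eleven` (**`l = 11`: `k ≥ 13`**), `…_thirteen` (**`l = 13`: `k ≥ 12`**),
  `…_of_le_67` (**`17 ≤ l ≤ 67`: `k ≥ 11`**).
* §3 under `hloc60 : ∀ x | 7, e(K_x/ℚ_7) ≤ 60·l` (the lemma as ANNOUNCED, `e ∣ 60·l`; `n = 4` for `l ≤ 240`): `…_of_localType60_eleven`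
  (**`k ≥ 15`**), `…_thirteen` (**`k ≥ 14`**), `…_of_le_240` (**`17 ≤ l ≤ 240`: `k ≥ 13`**).
The binders `hloc30` / `hloc60` are HYPOTHESES of these theorems (no new `Prop` is defined); they are discharged datum-free the moment the
LOCAL-TYPE LEMMA lands, and until then the corollaries record exactly what that lemma buys for the WINDOW-TABLE's HEX block (numerics F1-3:
`k = 12–16` ALLREF modulo the lemma; `k ≤ 9` WINDOW).

HONEST SCOPE: SHARP reading; per-label licence STRONGER THAN PRINT; a deep top-label packet says NOTHING about the printed GLOBAL inequality or the
number-level Corollary; refuted-as-typed ≠ refuted-in-print; no side taken; typed ≠ proved. [cite: Mochizuki2012, IUTchIII Cor. 3.12 Step (xi-f) p. 184;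
IUTchIV Prop. 1.2 p. 10, Prop. 1.8 (vii) p. 19, Cor. 2.2 (ii) proof (P5) p. 46] [claim: Mochizuki2012, status: disputed] for every IUT quotation.
-/

noncomputable section

open NumberField IsDedekindDomain

namespace Summit.ABC.IUTFork.Conditional

open Thm311 Thm311.Real Cor312 Cor312Prov Literature.IUT.LogVolume Literature.IUT.HodgeTheaters
  Literature.IUT.LogThetaLattice Literature.NumberTheory.NumberFields Literature.NumberTheory.DiophantineGeometry.GenEll
  Literature.NumberTheory.DiophantineGeometry

/-! ## §1. The engine, parametric in a per-place ramification bound `E` -/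

/-- **HEX-SHARP engine, parametric in the local type.** Let `l ≥ 11` be prime, `k ≥ 1`, and let `E`, `n` with `E < 6·7ⁿ` and the floor-free
integer criterion `l·((l+1)(10n+12)+20) ≤ 5k(l−3)(l+1)` (⟺ `(j+1)(n + 6/5) + 1 ≤ (k/l)(j²−1)`, `j = (l−1)/2`). Then at every genuine Θ-volume
datum `T` over `(ratPoint λ_k, l)` ALL of whose places `x | 7` have `e(K_x/ℚ_7) ≤ E`, the top label `i = j − 1` and a bad place `x₀ | 7` satisfy the
explicit depth inequality `7^{((i+2)(d+a+b)+1)}·‖t_q(x₀)‖^{(i+1)²−1} < 1` at the CHOSEN realising q-idele.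
[cite: Mochizuki2012, IUTchIII Cor. 3.12 Step (xi-f) p. 184; IUTchIV Prop. 1.2 p. 10] [claim: Mochizuki2012, status: disputed] -/
theorem GenuineK.exists_deep_place_lamSeven_of_ramBound {k l n E : ℕ} (hk : 1 ≤ k) (hl : l.Prime) (h11 : 11 ≤ l)
    (hEn : E < 6 * 7 ^ n) (hkl : l * ((l + 1) * (10 * n + 12) + 20) ≤ 5 * k * ((l - 3) * (l + 1)))
    (T : Cor22.ThetaVolumeDatumAt (ratPoint ((2 : ℚ)⁻¹ + 2 / 7 ^ k)) l)
    (hE : letI := T.instFieldF; letI := T.instNumberFieldF; letI := T.instAlgebraF; letI := T.instFieldK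
      letI := T.instNumberFieldK; letI := T.instAlgebraK; letI := T.instFieldFbar; letI := T.instAlgebraFbar
      letI := T.instAlgebraKFbar; letI := T.instIsElliptic
      haveI : Fact (Nat.Prime 7) := ⟨by norm_num⟩
      ∀ x : (thetaIndex (pilotDataOfK T.D T.K)).Fibre (.inr ⟨7, by norm_num⟩),
        absRamificationIdx 7 (kOf (pilotDataOfK T.D T.K) 7 x) ≤ E) :
    letI := T.instFieldF; letI := T.instNumberFieldF; letI := T.instAlgebraF; letI := T.instFieldK
    letI := T.instNumberFieldK; letI := T.instAlgebraK; letI := T.instFieldFbar; letI := T.instAlgebraFbar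
    letI := T.instAlgebraKFbar; letI := T.instIsElliptic
    haveI : Fact (Nat.Prime 7) := ⟨by norm_num⟩
    ∃ (i : Fin (thetaIndex (pilotDataOfK T.D T.K)).lstar) (x₀ : (thetaIndex (pilotDataOfK T.D T.K)).Fibre (.inr ⟨7, by norm_num⟩)),
      (i : ℕ) = (l - 1) / 2 - 1 ∧
      placeOf (pilotDataOfK T.D T.K) 7 x₀ ∈ (pilotDataOfK T.D T.K).S ∧
      (7 : ℝ) ^ ((((i : ℕ) : ℝ) + 2) * (differentOrd 7 (kOf (pilotDataOfK T.D T.K) 7 x₀)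
          + logRadiusA 7 (absRamificationIdx 7 (kOf (pilotDataOfK T.D T.K) 7 x₀))
          + logRadiusB 7 (absRamificationIdx 7 (kOf (pilotDataOfK T.D T.K) 7 x₀))) + 1) *
        ‖(exists_realising_qIdeles_pilotDataOfK T.D).choose ⟨7, by norm_num⟩ x₀‖ ^ (((i : ℕ) + 1) ^ 2 - 1) < 1 := by
  classical
  letI := T.instFieldF; letI := T.instNumberFieldF; letI := T.instAlgebraF; letI := T.instFieldK
  letI := T.instNumberFieldK; letI := T.instAlgebraK; letI := T.instFieldFbar; letI := T.instAlgebraFbar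
  letI := T.instAlgebraKFbar; letI := T.instIsElliptic
  haveI : Fact (Nat.Prime 7) := ⟨by norm_num⟩
  obtain ⟨x₀, hS, htame, -, -, hnorm⟩ := GenuineK.exists_place_lamSeven hk hl h11 T
  have hlstar : (thetaIndex (pilotDataOfK T.D T.K)).lstar = (l - 1) / 2 := rfl
  have hil : (l - 1) / 2 - 1 < (thetaIndex (pilotDataOfK T.D T.K)).lstar := by rw [hlstar]; omega
  refine ⟨⟨(l - 1) / 2 - 1, hil⟩, x₀, rfl, hS, ?_⟩
  have he : absRamificationIdx 7 (kOf (pilotDataOfK T.D T.K) 7 x₀) ≤ E := hE x₀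
  have hepos : 0 < absRamificationIdx 7 (kOf (pilotDataOfK T.D T.K) 7 x₀) := absRamificationIdx_pos _ _
  have he' : (0 : ℝ) < absRamificationIdx 7 (kOf (pilotDataOfK T.D T.K) 7 x₀) := by exact_mod_cast hepos
  set B : ℝ := n + 6 / 5 - 1 / (absRamificationIdx 7 (kOf (pilotDataOfK T.D T.K) 7 x₀) : ℝ) with hBdef
  have hX := HexSharp.depthConstants_le (kOf (pilotDataOfK T.D T.K) 7 x₀) n htame (lt_of_le_of_lt he hEn)
  set j : ℕ := (l - 1) / 2 with hj
  have h2j : 2 * j = l - 1 := by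
    have hodd : l % 2 = 1 := Nat.odd_iff.mp (hl.odd_of_ne_two (by omega))
    omega
  have hjR : (j : ℝ) = ((l : ℝ) - 1) / 2 := by
    have : ((2 * j : ℕ) : ℝ) = ((l - 1 : ℕ) : ℝ) := by exact_mod_cast h2j
    push_cast [Nat.cast_sub (show 1 ≤ l by omega)] at this
    linarith
  have hcast1 : ((((l - 1) / 2 - 1 : ℕ) : ℝ) + 2) = (j : ℝ) + 1 := by
    rw [← hj, Nat.cast_sub (show 1 ≤ j by omega)]
    push_cast; ring
  have hidx : (l - 1) / 2 - 1 + 1 = j := by rw [← hj]; omega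
  have hcast2 : (((j ^ 2 - 1 : ℕ)) : ℝ) = ((j : ℝ) - 1) * ((j : ℝ) + 1) := by
    have : 1 ≤ j ^ 2 := Nat.one_le_pow _ _ (by omega)
    push_cast [Nat.cast_sub this]
    ring
  have hl0 : (0 : ℝ) < l := by exact_mod_cast hl.pos
  have hklR : ((j : ℝ) + 1) * ((n : ℝ) + 6 / 5) + 1 ≤ (k : ℝ) / l * (((j : ℝ) - 1) * ((j : ℝ) + 1)) := by
    have h3 : 3 ≤ l := by omega
    have hR : ((l * ((l + 1) * (10 * n + 12) + 20) : ℕ) : ℝ) ≤ ((5 * k * ((l - 3) * (l + 1)) : ℕ) : ℝ) := by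
      exact_mod_cast hkl
    push_cast [Nat.cast_sub h3] at hR
    rw [hjR]
    rw [div_mul_eq_mul_div, le_div_iff₀ hl0]
    nlinarith
  have hlt : (((((l - 1) / 2 - 1 : ℕ)) : ℝ) + 2) * B + 1 <
      (k : ℝ) / l * ((((((l - 1) / 2 - 1 : ℕ)) + 1) ^ 2 - 1 : ℕ) : ℝ) := by
    rw [hcast1, hidx, hcast2, hBdef]
    have hpos : 0 < ((j : ℝ) + 1) * (1 / (absRamificationIdx 7 (kOf (pilotDataOfK T.D T.K) 7 x₀) : ℝ)) := by
      have : (0 : ℝ) < (j : ℝ) + 1 := by positivity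
      positivity
    nlinarith
  have h := rpow_mul_pow_lt_one_of_lt (p := (7 : ℝ)) (by norm_num) (i := (l - 1) / 2 - 1) hX hlt
  rw [hnorm]
  exact h

/-! ## §2. Under the LOCAL-TYPE bound `e ≤ 30·l` (`n = 3` for `l ≤ 68`) -/

/-- **`l = 11`, local type `e ≤ 330`: every `k ≥ 13`.** (`330 < 2058 = 6·7³`; `11·(12·42+20) = 5764 ≤ 6240 = 5·13·8·12`.)
[cite: Mochizuki2012, IUTchIII Cor. 3.12 Step (xi-f) p. 184; IUTchIV Prop. 1.2 p. 10] [claim: Mochizuki2012, status: disputed] -/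
theorem GenuineK.exists_deep_place_lamSeven_of_localType30_eleven {k : ℕ} (hk : 13 ≤ k)
    (T : Cor22.ThetaVolumeDatumAt (ratPoint ((2 : ℚ)⁻¹ + 2 / 7 ^ k)) 11)
    (hloc30 : letI := T.instFieldF; letI := T.instNumberFieldF; letI := T.instAlgebraF; letI := T.instFieldK
      letI := T.instNumberFieldK; letI := T.instAlgebraK; letI := T.instFieldFbar; letI := T.instAlgebraFbar
      letI := T.instAlgebraKFbar; letI := T.instIsElliptic
      haveI : Fact (Nat.Prime 7) := ⟨by norm_num⟩
      ∀ x : (thetaIndex (pilotDataOfK T.D T.K)).Fibre (.inr ⟨7, by norm_num⟩),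
        absRamificationIdx 7 (kOf (pilotDataOfK T.D T.K) 7 x) ≤ 30 * 11) :
    letI := T.instFieldF; letI := T.instNumberFieldF; letI := T.instAlgebraF; letI := T.instFieldK
    letI := T.instNumberFieldK; letI := T.instAlgebraK; letI := T.instFieldFbar; letI := T.instAlgebraFbar
    letI := T.instAlgebraKFbar; letI := T.instIsElliptic
    haveI : Fact (Nat.Prime 7) := ⟨by norm_num⟩
    ∃ (i : Fin (thetaIndex (pilotDataOfK T.D T.K)).lstar) (x₀ : (thetaIndex (pilotDataOfK T.D T.K)).Fibre (.inr ⟨7, by norm_num⟩)),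
      (i : ℕ) = 4 ∧
      placeOf (pilotDataOfK T.D T.K) 7 x₀ ∈ (pilotDataOfK T.D T.K).S ∧
      (7 : ℝ) ^ ((((i : ℕ) : ℝ) + 2) * (differentOrd 7 (kOf (pilotDataOfK T.D T.K) 7 x₀)
          + logRadiusA 7 (absRamificationIdx 7 (kOf (pilotDataOfK T.D T.K) 7 x₀))
          + logRadiusB 7 (absRamificationIdx 7 (kOf (pilotDataOfK T.D T.K) 7 x₀))) + 1) *
        ‖(exists_realising_qIdeles_pilotDataOfK T.D).choose ⟨7, by norm_num⟩ x₀‖ ^ (((i : ℕ) + 1) ^ 2 - 1) < 1 :=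
  GenuineK.exists_deep_place_lamSeven_of_ramBound (n := 3) (E := 30 * 11) (by omega) (by norm_num) le_rfl (by norm_num)
    (by nlinarith) T hloc30

/-- **`l = 13`, local type `e ≤ 390`: every `k ≥ 12`.** (`390 < 2058`; `13·(14·42+20) = 7904 ≤ 8400 = 5·12·10·14`.)
[cite: Mochizuki2012, IUTchIII Cor. 3.12 Step (xi-f) p. 184; IUTchIV Prop. 1.2 p. 10] [claim: Mochizuki2012, status: disputed] -/
theorem GenuineK.exists_deep_place_lamSeven_of_localType30_thirteen {k : ℕ} (hk : 12 ≤ k)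
    (T : Cor22.ThetaVolumeDatumAt (ratPoint ((2 : ℚ)⁻¹ + 2 / 7 ^ k)) 13)
    (hloc30 : letI := T.instFieldF; letI := T.instNumberFieldF; letI := T.instAlgebraF; letI := T.instFieldK
      letI := T.instNumberFieldK; letI := T.instAlgebraK; letI := T.instFieldFbar; letI := T.instAlgebraFbar
      letI := T.instAlgebraKFbar; letI := T.instIsElliptic
      haveI : Fact (Nat.Prime 7) := ⟨by norm_num⟩
      ∀ x : (thetaIndex (pilotDataOfK T.D T.K)).Fibre (.inr ⟨7, by norm_num⟩),
        absRamificationIdx 7 (kOf (pilotDataOfK T.D T.K) 7 x) ≤ 30 * 13) :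
    letI := T.instFieldF; letI := T.instNumberFieldF; letI := T.instAlgebraF; letI := T.instFieldK
    letI := T.instNumberFieldK; letI := T.instAlgebraK; letI := T.instFieldFbar; letI := T.instAlgebraFbar
    letI := T.instAlgebraKFbar; letI := T.instIsElliptic
    haveI : Fact (Nat.Prime 7) := ⟨by norm_num⟩
    ∃ (i : Fin (thetaIndex (pilotDataOfK T.D T.K)).lstar) (x₀ : (thetaIndex (pilotDataOfK T.D T.K)).Fibre (.inr ⟨7, by norm_num⟩)),
      (i : ℕ) = 5 ∧
      placeOf (pilotDataOfK T.D T.K) 7 x₀ ∈ (pilotDataOfK T.D T.K).S ∧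
      (7 : ℝ) ^ ((((i : ℕ) : ℝ) + 2) * (differentOrd 7 (kOf (pilotDataOfK T.D T.K) 7 x₀)
          + logRadiusA 7 (absRamificationIdx 7 (kOf (pilotDataOfK T.D T.K) 7 x₀))
          + logRadiusB 7 (absRamificationIdx 7 (kOf (pilotDataOfK T.D T.K) 7 x₀))) + 1) *
        ‖(exists_realising_qIdeles_pilotDataOfK T.D).choose ⟨7, by norm_num⟩ x₀‖ ^ (((i : ℕ) + 1) ^ 2 - 1) < 1 :=
  GenuineK.exists_deep_place_lamSeven_of_ramBound (n := 3) (E := 30 * 13) (by omega) (by norm_num) (by norm_num) (by norm_num)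
    (by nlinarith) T hloc30

/-- **`17 ≤ l ≤ 67` prime, local type `e ≤ 30·l`: every `k ≥ 11`.** (`30·67 = 2010 < 2058`; `l((l+1)·42+20) ≤ 55(l−3)(l+1)` for `l ≥ 17`,
i.e. `13l² ≥ 172l + 165`.) [cite: Mochizuki2012, IUTchIII Cor. 3.12 Step (xi-f) p. 184; IUTchIV Prop. 1.2 p. 10] [claim: Mochizuki2012, status: disputed] -/
theorem GenuineK.exists_deep_place_lamSeven_of_localType30_of_le_67 {k l : ℕ} (hk : 11 ≤ k) (hl : l.Prime) (h17 : 17 ≤ l)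
    (h67 : l ≤ 67) (T : Cor22.ThetaVolumeDatumAt (ratPoint ((2 : ℚ)⁻¹ + 2 / 7 ^ k)) l)
    (hloc30 : letI := T.instFieldF; letI := T.instNumberFieldF; letI := T.instAlgebraF; letI := T.instFieldK
      letI := T.instNumberFieldK; letI := T.instAlgebraK; letI := T.instFieldFbar; letI := T.instAlgebraFbar
      letI := T.instAlgebraKFbar; letI := T.instIsElliptic
      haveI : Fact (Nat.Prime 7) := ⟨by norm_num⟩
      ∀ x : (thetaIndex (pilotDataOfK T.D T.K)).Fibre (.inr ⟨7, by norm_num⟩),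
        absRamificationIdx 7 (kOf (pilotDataOfK T.D T.K) 7 x) ≤ 30 * l) :
    letI := T.instFieldF; letI := T.instNumberFieldF; letI := T.instAlgebraF; letI := T.instFieldK
    letI := T.instNumberFieldK; letI := T.instAlgebraK; letI := T.instFieldFbar; letI := T.instAlgebraFbar
    letI := T.instAlgebraKFbar; letI := T.instIsElliptic
    haveI : Fact (Nat.Prime 7) := ⟨by norm_num⟩
    ∃ (i : Fin (thetaIndex (pilotDataOfK T.D T.K)).lstar) (x₀ : (thetaIndex (pilotDataOfK T.D T.K)).Fibre (.inr ⟨7, by norm_num⟩)),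
      (i : ℕ) = (l - 1) / 2 - 1 ∧
      placeOf (pilotDataOfK T.D T.K) 7 x₀ ∈ (pilotDataOfK T.D T.K).S ∧
      (7 : ℝ) ^ ((((i : ℕ) : ℝ) + 2) * (differentOrd 7 (kOf (pilotDataOfK T.D T.K) 7 x₀)
          + logRadiusA 7 (absRamificationIdx 7 (kOf (pilotDataOfK T.D T.K) 7 x₀))
          + logRadiusB 7 (absRamificationIdx 7 (kOf (pilotDataOfK T.D T.K) 7 x₀))) + 1) *
        ‖(exists_realising_qIdeles_pilotDataOfK T.D).choose ⟨7, by norm_num⟩ x₀‖ ^ (((i : ℕ) + 1) ^ 2 - 1) < 1 := by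
  refine GenuineK.exists_deep_place_lamSeven_of_ramBound (n := 3) (E := 30 * l) (by omega) hl (by omega) (by norm_num; omega) ?_ T hloc30
  have hk' : 5 * 11 * ((l - 3) * (l + 1)) ≤ 5 * k * ((l - 3) * (l + 1)) :=
    Nat.mul_le_mul_right _ (Nat.mul_le_mul_left _ hk)
  refine le_trans ?_ hk'
  have h3 : 3 ≤ l := by omega
  zify [h3]
  have h17' : (17 : ℤ) ≤ (l : ℤ) := by exact_mod_cast h17
  nlinarith [mul_nonneg (sub_nonneg.mpr h17') (by positivity : (0 : ℤ) ≤ 13 * (l : ℤ) + 49)]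

/-! ## §3. Under the LOCAL-TYPE bound `e ≤ 60·l` (the lemma as announced; `n = 4` for `l ≤ 240`) -/

/-- **`l = 11`, local type `e ≤ 660`: every `k ≥ 15`.** (`660 < 14406 = 6·7⁴`; `11·(12·52+20) = 7084 ≤ 7200 = 5·15·8·12`.)
[cite: Mochizuki2012, IUTchIII Cor. 3.12 Step (xi-f) p. 184; IUTchIV Prop. 1.2 p. 10] [claim: Mochizuki2012, status: disputed] -/
theorem GenuineK.exists_deep_place_lamSeven_of_localType60_eleven {k : ℕ} (hk : 15 ≤ k)
    (T : Cor22.ThetaVolumeDatumAt (ratPoint ((2 : ℚ)⁻¹ + 2 / 7 ^ k)) 11)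
    (hloc60 : letI := T.instFieldF; letI := T.instNumberFieldF; letI := T.instAlgebraF; letI := T.instFieldK
      letI := T.instNumberFieldK; letI := T.instAlgebraK; letI := T.instFieldFbar; letI := T.instAlgebraFbar
      letI := T.instAlgebraKFbar; letI := T.instIsElliptic
      haveI : Fact (Nat.Prime 7) := ⟨by norm_num⟩
      ∀ x : (thetaIndex (pilotDataOfK T.D T.K)).Fibre (.inr ⟨7, by norm_num⟩),
        absRamificationIdx 7 (kOf (pilotDataOfK T.D T.K) 7 x) ≤ 60 * 11) :
    letI := T.instFieldF; letI := T.instNumberFieldF; letI := T.instAlgebraF; letI := T.instFieldK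
    letI := T.instNumberFieldK; letI := T.instAlgebraK; letI := T.instFieldFbar; letI := T.instAlgebraFbar
    letI := T.instAlgebraKFbar; letI := T.instIsElliptic
    haveI : Fact (Nat.Prime 7) := ⟨by norm_num⟩
    ∃ (i : Fin (thetaIndex (pilotDataOfK T.D T.K)).lstar) (x₀ : (thetaIndex (pilotDataOfK T.D T.K)).Fibre (.inr ⟨7, by norm_num⟩)),
      (i : ℕ) = 4 ∧
      placeOf (pilotDataOfK T.D T.K) 7 x₀ ∈ (pilotDataOfK T.D T.K).S ∧
      (7 : ℝ) ^ ((((i : ℕ) : ℝ) + 2) * (differentOrd 7 (kOf (pilotDataOfK T.D T.K) 7 x₀)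
          + logRadiusA 7 (absRamificationIdx 7 (kOf (pilotDataOfK T.D T.K) 7 x₀))
          + logRadiusB 7 (absRamificationIdx 7 (kOf (pilotDataOfK T.D T.K) 7 x₀))) + 1) *
        ‖(exists_realising_qIdeles_pilotDataOfK T.D).choose ⟨7, by norm_num⟩ x₀‖ ^ (((i : ℕ) + 1) ^ 2 - 1) < 1 :=
  GenuineK.exists_deep_place_lamSeven_of_ramBound (n := 4) (E := 60 * 11) (by omega) (by norm_num) le_rfl (by norm_num)
    (by nlinarith) T hloc60

/-- **`l = 13`, local type `e ≤ 780`: every `k ≥ 14`.** (`780 < 14406`; `13·(14·52+20) = 9724 ≤ 9800 = 5·14·10·14`.)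
[cite: Mochizuki2012, IUTchIII Cor. 3.12 Step (xi-f) p. 184; IUTchIV Prop. 1.2 p. 10] [claim: Mochizuki2012, status: disputed] -/
theorem GenuineK.exists_deep_place_lamSeven_of_localType60_thirteen {k : ℕ} (hk : 14 ≤ k)
    (T : Cor22.ThetaVolumeDatumAt (ratPoint ((2 : ℚ)⁻¹ + 2 / 7 ^ k)) 13)
    (hloc60 : letI := T.instFieldF; letI := T.instNumberFieldF; letI := T.instAlgebraF; letI := T.instFieldK
      letI := T.instNumberFieldK; letI := T.instAlgebraK; letI := T.instFieldFbar; letI := T.instAlgebraFbar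
      letI := T.instAlgebraKFbar; letI := T.instIsElliptic
      haveI : Fact (Nat.Prime 7) := ⟨by norm_num⟩
      ∀ x : (thetaIndex (pilotDataOfK T.D T.K)).Fibre (.inr ⟨7, by norm_num⟩),
        absRamificationIdx 7 (kOf (pilotDataOfK T.D T.K) 7 x) ≤ 60 * 13) :
    letI := T.instFieldF; letI := T.instNumberFieldF; letI := T.instAlgebraF; letI := T.instFieldK
    letI := T.instNumberFieldK; letI := T.instAlgebraK; letI := T.instFieldFbar; letI := T.instAlgebraFbar
    letI := T.instAlgebraKFbar; letI := T.instIsElliptic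
    haveI : Fact (Nat.Prime 7) := ⟨by norm_num⟩
    ∃ (i : Fin (thetaIndex (pilotDataOfK T.D T.K)).lstar) (x₀ : (thetaIndex (pilotDataOfK T.D T.K)).Fibre (.inr ⟨7, by norm_num⟩)),
      (i : ℕ) = 5 ∧
      placeOf (pilotDataOfK T.D T.K) 7 x₀ ∈ (pilotDataOfK T.D T.K).S ∧
      (7 : ℝ) ^ ((((i : ℕ) : ℝ) + 2) * (differentOrd 7 (kOf (pilotDataOfK T.D T.K) 7 x₀)
          + logRadiusA 7 (absRamificationIdx 7 (kOf (pilotDataOfK T.D T.K) 7 x₀))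
          + logRadiusB 7 (absRamificationIdx 7 (kOf (pilotDataOfK T.D T.K) 7 x₀))) + 1) *
        ‖(exists_realising_qIdeles_pilotDataOfK T.D).choose ⟨7, by norm_num⟩ x₀‖ ^ (((i : ℕ) + 1) ^ 2 - 1) < 1 :=
  GenuineK.exists_deep_place_lamSeven_of_ramBound (n := 4) (E := 60 * 13) (by omega) (by norm_num) (by norm_num) (by norm_num)
    (by nlinarith) T hloc60

/-- **`17 ≤ l ≤ 240` prime, local type `e ≤ 60·l`: every `k ≥ 13`.** (`60·240 = 14400 < 14406 = 6·7⁴`; `l((l+1)·52+20) ≤ 65(l−3)(l+1)` for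
`l ≥ 17`, i.e. `13l² ≥ 202l + 195`.) [cite: Mochizuki2012, IUTchIII Cor. 3.12 Step (xi-f) p. 184; IUTchIV Prop. 1.2 p. 10] [claim: Mochizuki2012, status: disputed] -/
theorem GenuineK.exists_deep_place_lamSeven_of_localType60_of_le_240 {k l : ℕ} (hk : 13 ≤ k) (hl : l.Prime) (h17 : 17 ≤ l)
    (h240 : l ≤ 240) (T : Cor22.ThetaVolumeDatumAt (ratPoint ((2 : ℚ)⁻¹ + 2 / 7 ^ k)) l)
    (hloc60 : letI := T.instFieldF; letI := T.instNumberFieldF; letI := T.instAlgebraF; letI := T.instFieldK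
      letI := T.instNumberFieldK; letI := T.instAlgebraK; letI := T.instFieldFbar; letI := T.instAlgebraFbar
      letI := T.instAlgebraKFbar; letI := T.instIsElliptic
      haveI : Fact (Nat.Prime 7) := ⟨by norm_num⟩
      ∀ x : (thetaIndex (pilotDataOfK T.D T.K)).Fibre (.inr ⟨7, by norm_num⟩),
        absRamificationIdx 7 (kOf (pilotDataOfK T.D T.K) 7 x) ≤ 60 * l) :
    letI := T.instFieldF; letI := T.instNumberFieldF; letI := T.instAlgebraF; letI := T.instFieldK
    letI := T.instNumberFieldK; letI := T.instAlgebraK; letI := T.instFieldFbar; letI := T.instAlgebraFbar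
    letI := T.instAlgebraKFbar; letI := T.instIsElliptic
    haveI : Fact (Nat.Prime 7) := ⟨by norm_num⟩
    ∃ (i : Fin (thetaIndex (pilotDataOfK T.D T.K)).lstar) (x₀ : (thetaIndex (pilotDataOfK T.D T.K)).Fibre (.inr ⟨7, by norm_num⟩)),
      (i : ℕ) = (l - 1) / 2 - 1 ∧
      placeOf (pilotDataOfK T.D T.K) 7 x₀ ∈ (pilotDataOfK T.D T.K).S ∧
      (7 : ℝ) ^ ((((i : ℕ) : ℝ) + 2) * (differentOrd 7 (kOf (pilotDataOfK T.D T.K) 7 x₀)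
          + logRadiusA 7 (absRamificationIdx 7 (kOf (pilotDataOfK T.D T.K) 7 x₀))
          + logRadiusB 7 (absRamificationIdx 7 (kOf (pilotDataOfK T.D T.K) 7 x₀))) + 1) *
        ‖(exists_realising_qIdeles_pilotDataOfK T.D).choose ⟨7, by norm_num⟩ x₀‖ ^ (((i : ℕ) + 1) ^ 2 - 1) < 1 := by
  refine GenuineK.exists_deep_place_lamSeven_of_ramBound (n := 4) (E := 60 * l) (by omega) hl (by omega) (by norm_num; omega) ?_ T hloc60
  have hk' : 5 * 13 * ((l - 3) * (l + 1)) ≤ 5 * k * ((l - 3) * (l + 1)) :=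
    Nat.mul_le_mul_right _ (Nat.mul_le_mul_left _ hk)
  refine le_trans ?_ hk'
  have h3 : 3 ≤ l := by omega
  zify [h3]
  have h17' : (17 : ℤ) ≤ (l : ℤ) := by exact_mod_cast h17
  nlinarith [mul_nonneg (sub_nonneg.mpr h17') (by positivity : (0 : ℤ) ≤ 13 * (l : ℤ) + 19)]

end Summit.ABC.IUTFork.Conditional

end
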